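import Mathlib
import Summits.Ventures.PercRepro2.CoinChainXASixTopGate
import Summits.Ventures.PercRepro2.CoinChainXAClosedGateSums

/-!
# The `GR1` fact: the `j`-marked surviving clusters are `y`-richer than the world-1 law
(blind cell PercRepro2, night-2 g32; proofs/NIGHT2-DARC.md §73.7g)

`cg_fact_GR1`: for `ent = {m}` and the markers vanishing on the ideal, with `R¹ = ν·(c on the ideal, d elsewhere)` the
chain's world-1 law, `(XU + XM)·(YU + YM) ≤ (a + u + t)·(XYU + XYM)` — «FKG for `R¹` across the marker `x`»: one
four-functions instance over the whole lattice with `L₁ = νd·x`, `L₂ = R¹·y`, `L₃ = R¹`, `L₄ = νd·xy`; the pointwise law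
inequality `d(s)·R¹(t) ≤ R¹(s ∩ t)·d(s ∪ t)` for `s` outside the ideal holds by `hcd`, `hdd` and `d ≤ c`.
-/

namespace Summit.Ventures.PercRepro2.Coin

open Classical

section GR1Fact

variable {V : Type*} [DecidableEq V] {R : Type*} [Field R] [LinearOrder R] [IsStrictOrderedRing R]

/-- The pointwise law inequality of the `GR1` fact: `d(s)·R¹(t) ≤ R¹(s ∩ t)·d(s ∪ t)`. -/
theorem gr1_law_pw (m : V) (ent' : Finset V) (c d : Finset V → R) (hd0 : ∀ W, 0 ≤ d W) (hdc : ∀ W, d W ≤ c W)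
    (hcd : ∀ s t, c s * d t ≤ c (s ∩ t) * d (s ∪ t)) (hdd : ∀ s t, d s * d t ≤ d (s ∩ t) * d (s ∪ t)) (s t : Finset V) :
    d s * (if ∃ r ∈ ({m} : Finset V) ∪ ent', r ∈ t then d t else c t) ≤
      (if ∃ r ∈ ({m} : Finset V) ∪ ent', r ∈ s ∩ t then d (s ∩ t) else c (s ∩ t)) * d (s ∪ t) := by
  by_cases ht : ∃ r ∈ ({m} : Finset V) ∪ ent', r ∈ t
  · rw [if_pos ht]
    by_cases hst : ∃ r ∈ ({m} : Finset V) ∪ ent', r ∈ s ∩ t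
    · rw [if_pos hst]; exact hdd s t
    · rw [if_neg hst]
      calc d s * d t ≤ d (s ∩ t) * d (s ∪ t) := hdd s t
        _ ≤ c (s ∩ t) * d (s ∪ t) := mul_le_mul_of_nonneg_right (hdc _) (hd0 _)
  · rw [if_neg ht]
    have hst : ¬ ∃ r ∈ ({m} : Finset V) ∪ ent', r ∈ s ∩ t := fun ⟨r, hr, hrt⟩ => ht ⟨r, hr, (Finset.mem_inter.1 hrt).2⟩
    rw [if_neg hst]
    calc d s * c t = c t * d s := by ring
      _ ≤ c (t ∩ s) * d (t ∪ s) := hcd t s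
      _ = c (s ∩ t) * d (s ∪ t) := by rw [Finset.inter_comm, Finset.union_comm]

/-- **The `GR1` fact** `(XU + XM)·(YU + YM) ≤ (a + u + t)·(XYU + XYM)`: the `j`-marked surviving clusters are `y`-richer
than the world-1 law `R¹ = ν·(c on the ideal, d on the coin- and sure-entered clusters)`. -/
theorem cg_fact_GR1 (U : Finset V) (m : V) (ent' : Finset V) (ν c d : Finset V → R)
    (hν0 : ∀ W, 0 ≤ ν W) (hν : ∀ s ⊆ U, ∀ t ⊆ U, ν s * ν t ≤ ν (s ∩ t) * ν (s ∪ t))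
    (hc0 : ∀ W, 0 ≤ c W) (hd0 : ∀ W, 0 ≤ d W) (hdc : ∀ W, d W ≤ c W)
    (hcd : ∀ s t, c s * d t ≤ c (s ∩ t) * d (s ∪ t)) (hdd : ∀ s t, d s * d t ≤ d (s ∩ t) * d (s ∪ t))
    (x y : Finset V → R) (hx0 : ∀ W, 0 ≤ x W) (hy0 : ∀ W, 0 ≤ y W)
    (hxm : ∀ s t, x s ≤ x (s ∪ t)) (hym : ∀ s t, y s ≤ y (s ∪ t))
    (hxI : ∀ W, (¬ ∃ r ∈ ({m} : Finset V) ∪ ent', r ∈ W) → x W = 0)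
    (hyI : ∀ W, (¬ ∃ r ∈ ({m} : Finset V) ∪ ent', r ∈ W) → y W = 0) :
    ((∑ W ∈ U.powerset.filter (fun W => (¬ ∃ r ∈ ({m} : Finset V), r ∈ W) ∧ ∃ r ∈ ent', r ∈ W), ν W * d W * x W)
        + (∑ W ∈ U.powerset.filter (fun W => ∃ r ∈ ({m} : Finset V), r ∈ W), ν W * d W * x W))
      * ((∑ W ∈ U.powerset.filter (fun W => (¬ ∃ r ∈ ({m} : Finset V), r ∈ W) ∧ ∃ r ∈ ent', r ∈ W), ν W * d W * y W)
        + (∑ W ∈ U.powerset.filter (fun W => ∃ r ∈ ({m} : Finset V), r ∈ W), ν W * d W * y W)) ≤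
    ((∑ W ∈ U.powerset.filter (fun W => ¬ ∃ r ∈ ({m} : Finset V) ∪ ent', r ∈ W), ν W * c W)
        + (∑ W ∈ U.powerset.filter (fun W => (¬ ∃ r ∈ ({m} : Finset V), r ∈ W) ∧ ∃ r ∈ ent', r ∈ W), ν W * d W)
        + (∑ W ∈ U.powerset.filter (fun W => ∃ r ∈ ({m} : Finset V), r ∈ W), ν W * d W))
      * ((∑ W ∈ U.powerset.filter (fun W => (¬ ∃ r ∈ ({m} : Finset V), r ∈ W) ∧ ∃ r ∈ ent', r ∈ W), ν W * d W * (x W * y W))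
        + (∑ W ∈ U.powerset.filter (fun W => ∃ r ∈ ({m} : Finset V), r ∈ W), ν W * d W * (x W * y W))) := by
  set ρ : Finset V → R := fun W => if ∃ r ∈ ({m} : Finset V) ∪ ent', r ∈ W then d W else c W with hρ
  have hρ0 : ∀ W, 0 ≤ ρ W := fun W => by simp only [hρ]; split_ifs <;> [exact hd0 W; exact hc0 W]
  have key := ad_sets_dec U (fun W => ν W * d W * x W) (fun W => ν W * ρ W * y W) (fun W => ν W * ρ W)
    (fun W => ν W * d W * (x W * y W))
    (fun W => mul_nonneg (mul_nonneg (hν0 W) (hd0 W)) (hx0 W)) (fun W => mul_nonneg (mul_nonneg (hν0 W) (hρ0 W)) (hy0 W))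
    (fun W => mul_nonneg (hν0 W) (hρ0 W)) (fun W => mul_nonneg (mul_nonneg (hν0 W) (hd0 W)) (mul_nonneg (hx0 W) (hy0 W)))
    (fun _ => True) (fun _ => True) (fun _ => True) (fun _ => True) (by
      intro s hs t ht _ _
      refine ⟨trivial, trivial, ?_⟩
      have hxt : x s ≤ x (s ∪ t) := hxm s t
      have hyt : y t ≤ y (s ∪ t) := by rw [Finset.union_comm]; exact hym t s
      have hlaw : d s * ρ t ≤ ρ (s ∩ t) * d (s ∪ t) := by
        simp only [hρ]; exact gr1_law_pw m ent' c d hd0 hdc hcd hdd s t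
      calc ν s * d s * x s * (ν t * ρ t * y t) = (ν s * ν t) * (d s * ρ t) * (x s * y t) := by ring
        _ ≤ (ν (s ∩ t) * ν (s ∪ t)) * (ρ (s ∩ t) * d (s ∪ t)) * (x (s ∪ t) * y (s ∪ t)) :=
            mul_le_mul (mul_le_mul (hν s hs t ht) hlaw (mul_nonneg (hd0 s) (hρ0 t)) (mul_nonneg (hν0 _) (hν0 _)))
              (mul_le_mul hxt hyt (hy0 t) (hx0 _)) (mul_nonneg (hx0 s) (hy0 t))
              (mul_nonneg (mul_nonneg (hν0 _) (hν0 _)) (mul_nonneg (hρ0 _) (hd0 _)))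
        _ = ν (s ∩ t) * ρ (s ∩ t) * (ν (s ∪ t) * d (s ∪ t) * (x (s ∪ t) * y (s ∪ t))) := by ring)
  simp only [Finset.filter_true] at key
  rw [sum_three_regions U {m} ent', sum_three_regions U {m} ent' (fun W => ν W * ρ W * y W),
    sum_three_regions U {m} ent' (fun W => ν W * ρ W), sum_three_regions U {m} ent' (fun W => ν W * d W * (x W * y W))] at key
  have hI1 : (∑ W ∈ U.powerset.filter (fun W => ¬ ∃ r ∈ ({m} : Finset V) ∪ ent', r ∈ W), ν W * d W * x W) = 0 :=
    cgate_sum_zero U _ _ (fun W hW => by rw [hxI W hW, mul_zero])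
  have hI2 : (∑ W ∈ U.powerset.filter (fun W => ¬ ∃ r ∈ ({m} : Finset V) ∪ ent', r ∈ W), ν W * ρ W * y W) = 0 :=
    cgate_sum_zero U _ _ (fun W hW => by rw [hyI W hW, mul_zero])
  have hI4 : (∑ W ∈ U.powerset.filter (fun W => ¬ ∃ r ∈ ({m} : Finset V) ∪ ent', r ∈ W), ν W * d W * (x W * y W)) = 0 :=
    cgate_sum_zero U _ _ (fun W hW => by rw [hxI W hW, zero_mul, mul_zero])
  have hI3 : (∑ W ∈ U.powerset.filter (fun W => ¬ ∃ r ∈ ({m} : Finset V) ∪ ent', r ∈ W), ν W * ρ W)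
      = ∑ W ∈ U.powerset.filter (fun W => ¬ ∃ r ∈ ({m} : Finset V) ∪ ent', r ∈ W), ν W * c W :=
    Finset.sum_congr rfl (fun W hW => by simp only [hρ, if_neg (Finset.mem_filter.1 hW).2])
  have hD : ∀ W : Finset V, ((¬ ∃ r ∈ ({m} : Finset V), r ∈ W) ∧ ∃ r ∈ ent', r ∈ W) → ∃ r ∈ ({m} : Finset V) ∪ ent', r ∈ W :=
    fun W h => by obtain ⟨r, hr, hrW⟩ := h.2; exact ⟨r, Finset.mem_union.2 (Or.inr hr), hrW⟩
  have hM : ∀ W : Finset V, (∃ r ∈ ({m} : Finset V), r ∈ W) → ∃ r ∈ ({m} : Finset V) ∪ ent', r ∈ W :=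
    fun W h => by obtain ⟨r, hr, hrW⟩ := h; exact ⟨r, Finset.mem_union.2 (Or.inl hr), hrW⟩
  have hD2 : (∑ W ∈ U.powerset.filter (fun W => (¬ ∃ r ∈ ({m} : Finset V), r ∈ W) ∧ ∃ r ∈ ent', r ∈ W), ν W * ρ W * y W)
      = ∑ W ∈ U.powerset.filter (fun W => (¬ ∃ r ∈ ({m} : Finset V), r ∈ W) ∧ ∃ r ∈ ent', r ∈ W), ν W * d W * y W :=
    Finset.sum_congr rfl (fun W hW => by simp only [hρ, if_pos (hD W (Finset.mem_filter.1 hW).2)])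
  have hD3 : (∑ W ∈ U.powerset.filter (fun W => (¬ ∃ r ∈ ({m} : Finset V), r ∈ W) ∧ ∃ r ∈ ent', r ∈ W), ν W * ρ W)
      = ∑ W ∈ U.powerset.filter (fun W => (¬ ∃ r ∈ ({m} : Finset V), r ∈ W) ∧ ∃ r ∈ ent', r ∈ W), ν W * d W :=
    Finset.sum_congr rfl (fun W hW => by simp only [hρ, if_pos (hD W (Finset.mem_filter.1 hW).2)])
  have hM2 : (∑ W ∈ U.powerset.filter (fun W => ∃ r ∈ ({m} : Finset V), r ∈ W), ν W * ρ W * y W)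
      = ∑ W ∈ U.powerset.filter (fun W => ∃ r ∈ ({m} : Finset V), r ∈ W), ν W * d W * y W :=
    Finset.sum_congr rfl (fun W hW => by simp only [hρ, if_pos (hM W (Finset.mem_filter.1 hW).2)])
  have hM3 : (∑ W ∈ U.powerset.filter (fun W => ∃ r ∈ ({m} : Finset V), r ∈ W), ν W * ρ W)
      = ∑ W ∈ U.powerset.filter (fun W => ∃ r ∈ ({m} : Finset V), r ∈ W), ν W * d W :=
    Finset.sum_congr rfl (fun W hW => by simp only [hρ, if_pos (hM W (Finset.mem_filter.1 hW).2)])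
  rw [hI1, hI2, hI3, hI4, hD2, hD3, hM2, hM3, zero_add, zero_add, zero_add] at key
  linear_combination key

end GR1Fact

end Summit.Ventures.PercRepro2.Coin
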